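import Summits.KontsevichZagierPeriods.Zeta5Search.WedgeDictionaryFaceRelation
import HarnessLib

/-!
# The four-term relation in the interior of the wedge dictionary (cell `pub-zeta5`)

HONEST FRAMING: systematic search; no irrationality claim unless certified.

OUR work (Summit side; ideation seat gen-1 g5, 2026-08-20).  Companion of `WedgeDictionaryFaceRelation`
(`face_threeTerm`, lit g4): there, on the face `b₇ = 0`, multiplying the Pochhammer numerator by the quadratic
`q` coming from `∏(x+N−b_k) − ∏(x+b_k)` gives a THREE-term summable combination in every coordinate direction.
In the INTERIOR (`b₇ ≥ 0` arbitrary, all seven slots present) the same manipulation fails, but the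
*dressed* telescoper `g = (X+N)(X−1)·h_b` (`h_b = hPoly b`, the extra factor is `y' − N` with `y' = X(X+N−1)`)
works: with `β = b₇` one gets the polynomial identity
`γ₃·numPoly(b+3e₇) + γ₂·numPoly(b+2e₇) + γ₁·numPoly(b+e₇) + γ₀·numPoly(b) = g(X+1)X⁶ − g(X)(X+N)⁶`
(`top_fourTerm`), where `γ₀,…,γ₃` (`topGamma0 … topGamma3`) are the Newton coefficients, at the nodes
`y_s = −s(N−s)`, `s = β, β+1, β+2`, of the cubic `q(y) = N_β(x)/(2x+N)`,
`N_β(x) = (x+β)(x+N+1)∏_{k≤6}(x+b_k) − (x+N−β)(x−1)∏_{k≤6}(x+N−b_k)` (`top_scalar_identity`, one `ring`);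
in particular `γ₃ = −(3N − β − 1 − e₁)` and `γ₀ = (β+1)∏_{k≤6}(N−β−b_k)`.  This is the relation (4T) of the
paper-level proof of `casoratianClosedForm` in the interior (HOME/pub-zeta5-gen-1/PROOF-NOTES-g5.md §4):
with RANK-TWO it yields a third-order recurrence for the Casoratian `M₃` along the slot `b₇`, whose solution
from the face values is the closed form (identities I1, I2, TELESCOPE of the notes, machine-verified symbolically).

Status: STAGED (HOME/lean), kernel-checked 2026-08-20 as a self-contained variant (the `FaceRelation`
preliminaries inlined, import `WedgeDictionaryRankTwo`): `lean check` rc 0, 0 sorries, 55 s.  Remark for the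
assembly: `face_threeTerm` holds verbatim also for the direction `i = 6` (slot `b₇`, from the face) — same proof with
`range 7` and seven `interval_cases`; that is the three-term relation (3T) giving the initial values of the recurrence.
-/

noncomputable section

open Finset Polynomial

namespace Summit.KontsevichZagierPeriods.Zeta5Search.WedgeDictionary

open Summit.KontsevichZagierPeriods.Zeta5Search.DualSeries
open Literature.NumberTheory.Transcendental
open Literature.NumberTheory.Transcendental.BallRivoal (pochPoly eval_pochPoly)

/-! ### Elementary symmetric functions `e₄, e₅, e₆` of the six slots `b₁,…,b₆` (`e₁,e₂,e₃`: `fe1,fe2,fe3`) -/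

/-- `e₄` of the six slots `b₁,…,b₆` (explicit sum of the 15 products). -/
def fe4 (b : ℕ → ℤ) : ℚ :=
  (b 1 : ℚ) * b 2 * b 3 * b 4 + (b 1 : ℚ) * b 2 * b 3 * b 5 + (b 1 : ℚ) * b 2 * b 3 * b 6 +
    (b 1 : ℚ) * b 2 * b 4 * b 5 + (b 1 : ℚ) * b 2 * b 4 * b 6 + (b 1 : ℚ) * b 2 * b 5 * b 6 +
    (b 1 : ℚ) * b 3 * b 4 * b 5 + (b 1 : ℚ) * b 3 * b 4 * b 6 + (b 1 : ℚ) * b 3 * b 5 * b 6 +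
    (b 1 : ℚ) * b 4 * b 5 * b 6 + (b 2 : ℚ) * b 3 * b 4 * b 5 + (b 2 : ℚ) * b 3 * b 4 * b 6 +
    (b 2 : ℚ) * b 3 * b 5 * b 6 + (b 2 : ℚ) * b 4 * b 5 * b 6 + (b 3 : ℚ) * b 4 * b 5 * b 6

/-- `e₅` of the six slots `b₁,…,b₆` (explicit sum of the 6 products). -/
def fe5 (b : ℕ → ℤ) : ℚ :=
  (b 1 : ℚ) * b 2 * b 3 * b 4 * b 5 + (b 1 : ℚ) * b 2 * b 3 * b 4 * b 6 + (b 1 : ℚ) * b 2 * b 3 * b 5 * b 6 +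
    (b 1 : ℚ) * b 2 * b 4 * b 5 * b 6 + (b 1 : ℚ) * b 3 * b 4 * b 5 * b 6 + (b 2 : ℚ) * b 3 * b 4 * b 5 * b 6

/-- `e₆` of the six slots `b₁,…,b₆`. -/
def fe6 (b : ℕ → ℤ) : ℚ := (b 1 : ℚ) * b 2 * b 3 * b 4 * b 5 * b 6

/-! ### The cubic `q(y) = a₀ + a₁y + a₂y² + a₃y³ = N_β(x)/(2x+N)`, `y = x(x+N)` -/

/-- Leading coefficient `a₃ = −3N + β + e₁ + 1` (`β = b₇`). -/
def topA3 (b : ℕ → ℤ) : ℚ := -3 * (b 0 : ℚ) + (b 7 : ℚ) + fe1 b + 1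

/-- `a₂`. -/
def topA2 (b : ℕ → ℤ) : ℚ :=
  -4 * (b 0 : ℚ) ^ 3 + 3 * (b 0 : ℚ) ^ 2 * (b 7 : ℚ) + 3 * (b 0 : ℚ) ^ 2 * fe1 b -
    2 * (b 0 : ℚ) * (b 7 : ℚ) * fe1 b + 6 * (b 0 : ℚ) ^ 2 - 3 * (b 0 : ℚ) * (b 7 : ℚ) - 3 * (b 0 : ℚ) * fe1 b -
    2 * (b 0 : ℚ) * fe2 b + (b 7 : ℚ) * fe1 b + (b 7 : ℚ) * fe2 b + fe2 b + fe3 b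

/-- `a₁`. -/
def topA1 (b : ℕ → ℤ) : ℚ :=
  -(b 0 : ℚ) ^ 5 + (b 0 : ℚ) ^ 4 * (b 7 : ℚ) + (b 0 : ℚ) ^ 4 * fe1 b - (b 0 : ℚ) ^ 3 * (b 7 : ℚ) * fe1 b +
    5 * (b 0 : ℚ) ^ 4 - 4 * (b 0 : ℚ) ^ 3 * (b 7 : ℚ) - 4 * (b 0 : ℚ) ^ 3 * fe1 b - (b 0 : ℚ) ^ 3 * fe2 b +
    3 * (b 0 : ℚ) ^ 2 * (b 7 : ℚ) * fe1 b + (b 0 : ℚ) ^ 2 * (b 7 : ℚ) * fe2 b + 3 * (b 0 : ℚ) ^ 2 * fe2 b +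
    (b 0 : ℚ) ^ 2 * fe3 b - 2 * (b 0 : ℚ) * (b 7 : ℚ) * fe2 b - (b 0 : ℚ) * (b 7 : ℚ) * fe3 b -
    2 * (b 0 : ℚ) * fe3 b - (b 0 : ℚ) * fe4 b + (b 7 : ℚ) * fe3 b + (b 7 : ℚ) * fe4 b + fe4 b + fe5 b

/-- `a₀`. -/
def topA0 (b : ℕ → ℤ) : ℚ :=
  (b 0 : ℚ) ^ 6 - (b 0 : ℚ) ^ 5 * (b 7 : ℚ) - (b 0 : ℚ) ^ 5 * fe1 b + (b 0 : ℚ) ^ 4 * (b 7 : ℚ) * fe1 b +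
    (b 0 : ℚ) ^ 4 * fe2 b - (b 0 : ℚ) ^ 3 * (b 7 : ℚ) * fe2 b - (b 0 : ℚ) ^ 3 * fe3 b +
    (b 0 : ℚ) ^ 2 * (b 7 : ℚ) * fe3 b + (b 0 : ℚ) ^ 2 * fe4 b - (b 0 : ℚ) * (b 7 : ℚ) * fe4 b -
    (b 0 : ℚ) * fe5 b + (b 7 : ℚ) * fe5 b + (b 7 : ℚ) * fe6 b + fe6 b

/-- The node `y_s = −s(N−s)` of the Newton basis. -/
def yNode (b : ℕ → ℤ) (s : ℚ) : ℚ := -s * ((b 0 : ℚ) - s)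

/-! ### Newton coefficients of `q` at the nodes `y_β, y_{β+1}, y_{β+2}` -/

/-- `γ₃ = a₃ = −(3N − β − 1 − e₁)`. -/
def topGamma3 (b : ℕ → ℤ) : ℚ := topA3 b

/-- `γ₂ = a₂ + a₃ (y_β + y_{β+1} + y_{β+2})`. -/
def topGamma2 (b : ℕ → ℤ) : ℚ :=
  topA2 b + topA3 b * (yNode b (b 7 : ℚ) + yNode b ((b 7 : ℚ) + 1) + yNode b ((b 7 : ℚ) + 2))

/-- `γ₁ = a₁ + a₂ (y_β + y_{β+1}) + a₃ (y_β² + y_β y_{β+1} + y_{β+1}²)`. -/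
def topGamma1 (b : ℕ → ℤ) : ℚ :=
  topA1 b + topA2 b * (yNode b (b 7 : ℚ) + yNode b ((b 7 : ℚ) + 1)) +
    topA3 b * (yNode b (b 7 : ℚ) ^ 2 + yNode b (b 7 : ℚ) * yNode b ((b 7 : ℚ) + 1) + yNode b ((b 7 : ℚ) + 1) ^ 2)

/-- `γ₀ = q(y_β) = (β+1) ∏_{k≤6} (N − β − b_k)`. -/
def topGamma0 (b : ℕ → ℤ) : ℚ :=
  topA0 b + topA1 b * yNode b (b 7 : ℚ) + topA2 b * yNode b (b 7 : ℚ) ^ 2 + topA3 b * yNode b (b 7 : ℚ) ^ 3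

/-- `γ₀ = (β+1) ∏_{k≤6} (N − β − b_k)`: the relation is non-degenerate exactly while `β + b_k < N` for all `k`. -/
theorem topGamma0_eq (b : ℕ → ℤ) :
    topGamma0 b = ((b 7 : ℚ) + 1) * ∏ k ∈ range 6, ((b 0 : ℚ) - b 7 - b (k + 1)) := by
  simp only [topGamma0, topA0, topA1, topA2, topA3, yNode, fe1, fe2, fe3, fe4, fe5, fe6, prod_range_succ,
    prod_range_zero]
  ring

/-- `γ₃ = −(d(b) − 1)` with `d(b) = 3N − Σ_{k≤7} b_k` (`dOf`). -/
theorem topGamma3_eq (b : ℕ → ℤ) : topGamma3 b = -((dOf b : ℚ) - 1) := by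
  simp only [topGamma3, topA3, fe1, dOf, sum_range_succ, sum_range_zero]
  push_cast
  ring

/-! ### The polynomial identity behind the four-term relation (one `ring`) -/

/-- `(2x+N)·[γ₀ + γ₁θ_β + γ₂θ_βθ_{β+1} + γ₃θ_βθ_{β+1}θ_{β+2}] = (x+β)(x+N+1)∏_{k≤6}(x+b_k) − (x+N−β)(x−1)∏_{k≤6}(x+N−b_k)`,
`θ_s = (x+s)(x+N−s) = y − y_s`. -/
theorem top_scalar_identity (b : ℕ → ℤ) (x : ℚ) :
    (2 * x + (b 0 : ℚ)) *
        (topGamma0 b + topGamma1 b * ((x + (b 7 : ℚ)) * (x + ((b 0 : ℚ) - b 7))) +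
          topGamma2 b * ((x + (b 7 : ℚ)) * (x + ((b 0 : ℚ) - b 7)) *
            ((x + ((b 7 : ℚ) + 1)) * (x + ((b 0 : ℚ) - b 7 - 1)))) +
          topGamma3 b * ((x + (b 7 : ℚ)) * (x + ((b 0 : ℚ) - b 7)) *
            ((x + ((b 7 : ℚ) + 1)) * (x + ((b 0 : ℚ) - b 7 - 1))) *
            ((x + ((b 7 : ℚ) + 2)) * (x + ((b 0 : ℚ) - b 7 - 2))))) =
      (x + (b 7 : ℚ)) * (x + ((b 0 : ℚ) + 1)) * (∏ k ∈ range 6, (x + (b (k + 1) : ℚ))) -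
        (x + ((b 0 : ℚ) - b 7)) * (x - 1) * ∏ k ∈ range 6, (x + ((b 0 : ℚ) - b (k + 1))) := by
  simp only [topGamma0, topGamma1, topGamma2, topGamma3, topA0, topA1, topA2, topA3, yNode, fe1, fe2, fe3,
    fe4, fe5, fe6, prod_range_succ, prod_range_zero]
  ring

/-! ### Pochhammer bookkeeping with all seven slots -/

/-- `h_b(x)(x+N)⁷ = A_b(x)·∏_{k≤7}(x+N−b_k)`, `A_b(x) = ∏_j (x)_{b_j}(x+N−b_j+1)_{b_j}` the Pochhammer part of `numPoly b`. -/
theorem hPoly_eval_mul_seven (b : ℕ → ℤ) (hb : InBox b) (x : ℚ) :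
    (∏ j ∈ range 7, (BallRivoal.poch x (b (j + 1)).toNat *
        BallRivoal.poch (x + ((b 0 - b (j + 1) : ℤ) : ℚ)) (b (j + 1)).toNat)) * (x + (b 0 : ℚ)) ^ 7 =
      (∏ j ∈ range 7, (BallRivoal.poch x (b (j + 1)).toNat *
        BallRivoal.poch (x + ((b 0 - b (j + 1) + 1 : ℤ) : ℚ)) (b (j + 1)).toNat)) *
        ∏ k ∈ range 7, (x + ((b 0 : ℚ) - b (k + 1))) := by
  rw [show (x + (b 0 : ℚ)) ^ 7 = ∏ _j ∈ range 7, (x + (b 0 : ℚ)) by rw [prod_const, card_range],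
    ← prod_mul_distrib, ← prod_mul_distrib]
  refine prod_congr rfl fun j hj => ?_
  have hm : (((b (j + 1)).toNat : ℕ) : ℚ) = (b (j + 1) : ℚ) := by exact_mod_cast Int.toNat_of_nonneg (hb.2 j hj).1
  have key := slot_shift_N x (b 0 : ℚ) (b (j + 1) : ℚ) (b (j + 1)).toNat hm
  push_cast
  linear_combination (-1 : ℚ) * key

/-- `h_b(x+1)x⁷ = A_b(x)·∏_{k≤7}(x+b_k)`. -/
theorem hPoly_eval_succ_mul_seven (b : ℕ → ℤ) (hb : InBox b) (x : ℚ) :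
    (∏ j ∈ range 7, (BallRivoal.poch (x + 1) (b (j + 1)).toNat *
        BallRivoal.poch (x + 1 + ((b 0 - b (j + 1) : ℤ) : ℚ)) (b (j + 1)).toNat)) * x ^ 7 =
      (∏ j ∈ range 7, (BallRivoal.poch x (b (j + 1)).toNat *
        BallRivoal.poch (x + ((b 0 - b (j + 1) + 1 : ℤ) : ℚ)) (b (j + 1)).toNat)) *
        ∏ k ∈ range 7, (x + (b (k + 1) : ℚ)) := by
  rw [show x ^ 7 = ∏ _j ∈ range 7, x by rw [prod_const, card_range], ← prod_mul_distrib, ← prod_mul_distrib]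
  refine prod_congr rfl fun j hj => ?_
  have hm : (((b (j + 1)).toNat : ℕ) : ℚ) = (b (j + 1) : ℚ) := by exact_mod_cast Int.toNat_of_nonneg (hb.2 j hj).1
  have key := slot_shift_zero x (b 0 : ℚ) (b (j + 1) : ℚ) (b (j + 1)).toNat hm
  push_cast
  linear_combination (-1 : ℚ) * key

/-! ### The four-term relation along the slot `b₇` -/

/-- The dressed telescoper `g = (X + N)(X − 1)·h_b` (`= (y' − N)·h_b`, `y' = X(X+N−1)`). -/
def topTelescoper (b : ℕ → ℤ) : ℚ[X] := (X + C (b 0 : ℚ)) * (X - C 1) * hPoly b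

/-- **The four-term relation along the slot `b₇`, as a polynomial identity.** For `b` in the box (all seven
slots, `β = b₇ ≥ 0` arbitrary):
`γ₃·numPoly(b+3e₇) + γ₂·numPoly(b+2e₇) + γ₁·numPoly(b+e₇) + γ₀·numPoly(b) = g(X+1)X⁶ − g(X)(X+N)⁶`,
`g = topTelescoper b`; i.e. the left-hand combination is SUMMABLE. -/
theorem top_fourTerm (b : ℕ → ℤ) (hb : InBox b) :
    C (topGamma3 b) * numPoly (bump (bump (bump b 6) 6) 6) + C (topGamma2 b) * numPoly (bump (bump b 6) 6) +
        C (topGamma1 b) * numPoly (bump b 6) + C (topGamma0 b) * numPoly b =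
      (topTelescoper b).comp (X + C 1) * X ^ 6 - topTelescoper b * (X + C (((b 0).toNat : ℕ) : ℚ)) ^ 6 := by
  have hi7 : (6 : ℕ) ∈ range 7 := mem_range.2 (by norm_num)
  have hβ0 : 0 ≤ b (6 + 1) := (hb.2 6 hi7).1
  have hN : (((b 0).toNat : ℕ) : ℚ) = (b 0 : ℚ) := by exact_mod_cast Int.toNat_of_nonneg hb.1
  have e1 : numPoly (bump b 6) = numPoly b * ((X + C (b (6 + 1) : ℚ)) * (X + C ((b 0 - b (6 + 1) : ℤ) : ℚ))) :=
    numPoly_update b hi7 hβ0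
  have e2 : numPoly (bump (bump b 6) 6) =
      numPoly (bump b 6) * ((X + C (bump b 6 (6 + 1) : ℚ)) * (X + C ((bump b 6 0 - bump b 6 (6 + 1) : ℤ) : ℚ))) :=
    numPoly_update (bump b 6) hi7 (by rw [bump_self]; omega)
  have e3 : numPoly (bump (bump (bump b 6) 6) 6) =
      numPoly (bump (bump b 6) 6) * ((X + C (bump (bump b 6) 6 (6 + 1) : ℚ)) *
        (X + C ((bump (bump b 6) 6 0 - bump (bump b 6) 6 (6 + 1) : ℤ) : ℚ))) :=
    numPoly_update (bump (bump b 6) 6) hi7 (by rw [bump_self, bump_self]; omega)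
  simp only [bump_self, bump_zero, Nat.reduceAdd] at e1 e2 e3
  apply Polynomial.funext
  intro x
  have hHA := hPoly_eval_mul_seven b hb x
  have hH1A := hPoly_eval_succ_mul_seven b hb x
  have estar := top_scalar_identity b x
  have e7a : ∏ k ∈ range 7, (x + (b (k + 1) : ℚ)) = (∏ k ∈ range 6, (x + (b (k + 1) : ℚ))) * (x + (b 7 : ℚ)) :=
    prod_range_succ _ 6
  have e7b : ∏ k ∈ range 7, (x + ((b 0 : ℚ) - b (k + 1))) =
      (∏ k ∈ range 6, (x + ((b 0 : ℚ) - b (k + 1)))) * (x + ((b 0 : ℚ) - b 7)) :=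
    prod_range_succ _ 6
  rw [e7a] at hH1A
  rw [e7b] at hHA
  rw [e3, e2, e1]
  simp only [topTelescoper, eval_mul, eval_add, eval_sub, eval_comp, eval_pow, eval_C, eval_X,
    eval_numPoly, eval_hPoly, hN]
  push_cast at hHA hH1A estar ⊢
  linear_combination (∏ j ∈ range 7, (BallRivoal.poch x (b (j + 1)).toNat *
      BallRivoal.poch (x + ((b 0 : ℚ) - (b (j + 1) : ℚ) + 1)) (b (j + 1)).toNat)) * estar -
    (x + (b 0 : ℚ) + 1) * hH1A + (x - 1) * hHA

end Summit.KontsevichZagierPeriods.Zeta5Search.WedgeDictionary
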